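import Summits.QuantumFields.QCD.Theorems.GaussianLinkFramesFrameAPrioriBoundLineDefs
import Summits.QuantumFields.QCD.Theorems.PauliWegnerSeaTiltedFlatness
import Summits.QuantumFields.QCD.Theorems.PauliWegnerSeaSingleLinkLogFlatnessDet
import Summits.QuantumFields.QCD.Theorems.PauliWegnerSeaSingleLinkLogFlatness
import Literature.MathematicalPhysics.QuantumFieldTheory.QCDPhaseQuenched
import Literature.MathematicalPhysics.QuantumLattice.GrassmannIntegralWilsonProofs

/-!
# Crux `FrameAPrioriBound` (stmt-QuantumFields-17374), line `cube-cofactor` — stub `stub_cubeSmallBall`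

Uniform RELATIVE small balls on the two-cube fibre: there are `c, α > 0` such that for every torus
`L ≥ 4`, mass `m₀`, spectral parameter `z`, sites `x, y`, background `U` and fibre point `W₀` with
`det (H(refit W₀) − z) ≠ 0`, `H = γ₅ D_W(·; m₀, 1)`,
`Haar^{⊗E} {W | |det(H(refit W) − z)| ≤ ε |det(H(refit W₀) − z)|} ≤ c ε^α` for every `ε > 0`.

Proof: this is the abstract Haar small-ball theorem `CircleTransport.stub_haarSmallBalls` of the
line `circle-transport` of crux `TiltedFlatness` (diagonal circle `exists_diagCircle`, Euler word
`stub_eulerWord`, flat-torus engine `stub_torusSmallBalls ∘ stub_circleEngine`) at degree `D = 48`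
and `n = 10⁴` listed links: the links touching `Q₂(x) ∪ Q₂(y)` are LISTED by
`(Bool × Bool) × (Fin 4 → Fin 5) × Fin 4` (base point `x`/`y`, edge starts/ends in the cube, offset in
`{0, ±1, ±2}⁴`, direction), the refit reads only listed links, `refit ∘ update = update ∘ refit` on
touched links (and `refit ∘ update = refit` off them), and along every two-sided circle
`t ↦ V[e ↦ A T(t) B]` the square `|det(H − z)|²` is a trigonometric polynomial of degree `≤ 48`
(Leibniz with row degrees, the public toolkit `SingleLinkLogFlatness.tp_*`: the entries of
`γ₅ D_W − z = diag(±1) D_W − z` in row `p` have degree `[p.1 = e.1] + [p.1 = e.1 + ê.2]`, total `24`;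
`|det|² = det · conj det`).  The constants depend on `D, n` only.
-/

noncomputable section

namespace Summit.QuantumFields.QCD.Cruxes.FrameAPrioriBound.CubeCofactor

open scoped BigOperators Matrix
open MeasureTheory Filter Literature.MathematicalPhysics.QuantumFieldTheory
  Literature.MathematicalPhysics.QuantumLattice Literature.Probability.LatticeModels

namespace SmallBall

open Complex Polynomial Summit.QuantumFields.QCD.Theorems.SingleLinkLogFlatness

variable {L : ℕ}

/-! ### Listing the touched links -/

/-- A site of the cube `Q₂(x)` is `x + (offsets in {0, 1, 2, -1, -2})` for some offset selector `δ`. -/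
theorem exists_off_of_inCube {x v : TorusSite 4 L} (h : inCube x v = true) :
    ∃ δ : Fin 4 → Fin 5, v = x + fun ν => (![0, 1, 2, -1, -2] : Fin 5 → ZMod L) (δ ν) := by
  simp only [inCube, decide_eq_true_eq] at h
  have h' : ∀ ν, ∃ j : Fin 5, v ν = x ν + (![0, 1, 2, -1, -2] : Fin 5 → ZMod L) j := by
    intro ν
    rcases h ν with h | h | h | h | h
    · exact ⟨0, by simpa using h⟩
    · exact ⟨1, by simpa using h⟩
    · exact ⟨2, by simpa using h⟩
    · exact ⟨3, by simp; linear_combination h⟩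
    · exact ⟨4, by simp; linear_combination h⟩
  choose δ hδ using h'
  exact ⟨δ, funext fun ν => hδ ν⟩

/-- The links that may touch `Q₂(x) ∪ Q₂(y)` are LISTED by (base point `x`/`y`, edge ends/starts in the
cube) × offset × direction — `10⁴` indices, uniformly in `L`: every touched link is listed. -/
theorem exists_listing (x y : TorusSite 4 L) :
    ∃ r : (Bool × Bool) × (Fin 4 → Fin 5) × Fin 4 → Edge 4 L, ∀ e : Edge 4 L, touches x y e = true →
      ∃ i, r i = e := by
  refine ⟨fun i => ((if i.1.1 then x else y) + (fun ν => (![0, 1, 2, -1, -2] : Fin 5 → ZMod L) (i.2.1 ν)) -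
    (if i.1.2 then Pi.single i.2.2 1 else 0), i.2.2), ?_⟩
  rintro ⟨v, μ⟩ h
  simp only [touches, Bool.or_eq_true] at h
  rcases h with ((h | h) | h) | h <;> obtain ⟨δ, hδ⟩ := exists_off_of_inCube h
  · exact ⟨((true, false), δ, μ), Prod.ext (by simp [hδ]) rfl⟩
  · exact ⟨((false, false), δ, μ), Prod.ext (by simp [hδ]) rfl⟩
  · refine ⟨((true, true), δ, μ), Prod.ext ?_ rfl⟩
    simp only [if_true, ← hδ]
    exact add_sub_cancel_right v _
  · refine ⟨((false, true), δ, μ), Prod.ext ?_ rfl⟩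
    simp only [if_true, Bool.false_eq_true, if_false, ← hδ]
    exact add_sub_cancel_right v _

/-! ### The band limit of `|det(H − z)|²` along a one-link circle -/

/-- The entries of the diagonal circle `diag(e^{iθ}, e^{-iθ}, 1)` lie in `T(1)` (the letters
`tp1_exp`, `tp1_exp_neg` of `SingleLinkLogFlatness`). -/
theorem tp1_diag (i j : Fin 3) : ∃ p : ℂ[X], p.natDegree ≤ 2 * 1 ∧ ∀ θ : ℝ,
    Matrix.diagonal ![cexp (θ * I), cexp (-(θ * I)), 1] i j =
      p.eval (cexp (θ * I)) * cexp (-((1 : ℕ) * θ * I)) := by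
  by_cases hij : i = j
  · subst hij
    simp only [Matrix.diagonal_apply_eq]
    fin_cases i
    exacts [tp1_exp, tp1_exp_neg, tp_const 1 1]
  · simp only [Matrix.diagonal_apply_ne _ hij]
    exact tp_const 1 0

/-- The entries of the two-sided circle `A T(θ) B` lie in `T(1)`. -/
theorem tp1_circle {T : ℝ → SU3} (hT : ∀ θ : ℝ, ((T θ : SU3) : Matrix (Fin 3) (Fin 3) ℂ) =
      Matrix.diagonal ![cexp (θ * I), cexp (-(θ * I)), 1]) (A B : SU3) (a b : Fin 3) :
    ∃ p : ℂ[X], p.natDegree ≤ 2 * 1 ∧ ∀ θ : ℝ,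
      ((A * T θ * B : SU3) : Matrix (Fin 3) (Fin 3) ℂ) a b =
        p.eval (cexp (θ * I)) * cexp (-((1 : ℕ) * θ * I)) := by
  obtain ⟨p, hp, h⟩ := tp_matrix_mul_mul (A : Matrix (Fin 3) (Fin 3) ℂ) (B : Matrix (Fin 3) (Fin 3) ℂ)
    (fun θ => Matrix.diagonal ![cexp (θ * I), cexp (-(θ * I)), 1]) tp1_diag a b
  refine ⟨p, hp, fun θ => ?_⟩
  rw [← h θ, ← hT θ, Submonoid.coe_mul, Submonoid.coe_mul]

/-- From the Laurent to the Fourier form: `P(e^{is}) e^{-ins} = ∑_{|k| ≤ n} P_{k+n} e^{iks}`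
(adapted from the private `tp_fourier` of `…TiltedFlatnessStubBandLimit`). -/
theorem fourier {n : ℕ} {F : ℝ → ℂ}
    (hF : ∃ P : ℂ[X], P.natDegree ≤ 2 * n ∧ ∀ s : ℝ,
      F s = P.eval (cexp (s * I)) * cexp (-(n * s * I))) :
    ∃ a : ℤ → ℂ, ∀ s : ℝ,
      F s = ∑ k ∈ Finset.Icc (-(n : ℤ)) (n : ℤ), a k * cexp ((k : ℂ) * (s : ℂ) * I) := by
  obtain ⟨P, hP, hF⟩ := hF
  refine ⟨fun k => P.coeff (k + n).toNat, fun s => ?_⟩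
  rw [(hF s).trans (mul_comm _ _), eval_eq_sum_range' (Nat.lt_succ_of_le hP), Int.Icc_eq_finset_map,
    Finset.sum_map, Finset.mul_sum, show ((n : ℤ) + 1 - -(n : ℤ)).toNat = 2 * n + 1 by omega]
  refine Finset.sum_congr rfl fun j _ => ?_
  simp only [Function.Embedding.trans_apply, Nat.castEmbedding_apply, addLeftEmbedding_apply]
  rw [show (-(n : ℤ) + j + n).toNat = j by omega, ← Complex.exp_nat_mul, mul_left_comm,
    ← Complex.exp_add]
  congr 2; push_cast; ring

/-- **Band limit.** Along a one-link curve `κ` with entries in `T(1)`, `|det(H(V[e ↦ κ(t)]) − z)|²`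
is a trigonometric polynomial of degree `≤ 48`, uniformly in `L`, `V`, `e`, `m₀`, `z`. -/
theorem band [NeZero L] (V : GaugeConfig 4 L SU3) (e : Edge 4 L) (κ : ℝ → SU3)
    (hκ : ∀ a b : Fin 3, ∃ p : ℂ[X], p.natDegree ≤ 2 * 1 ∧ ∀ θ : ℝ,
      (κ θ : Matrix (Fin 3) (Fin 3) ℂ) a b = p.eval (cexp (θ * I)) * cexp (-((1 : ℕ) * θ * I)))
    (m₀ : ℝ) (z : ℂ) :
    ∃ a : ℤ → ℂ, ∀ t : ℝ, ((‖(hz (Function.update V e (κ t)) m₀ z).det‖ ^ 2 : ℝ) : ℂ) =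
      ∑ k ∈ Finset.Icc (-((48 : ℕ) : ℤ)) ((48 : ℕ) : ℤ), a k * cexp ((k : ℂ) * (t : ℂ) * I) := by
  have hM : ∀ i j : TorusSite 4 L × Fin 3 × Fin 4, ∃ P : ℂ[X], P.natDegree ≤
      2 * ((fun p : TorusSite 4 L × Fin 3 × Fin 4 =>
        (if p.1 = e.1 then 1 else 0) + (if p.1 = e.1.shift e.2 then 1 else 0)) i) ∧ ∀ θ : ℝ,
      (fun θ => hz (Function.update V e (κ θ)) m₀ z) θ i j = P.eval (cexp (θ * I)) *
        cexp (-(((fun p : TorusSite 4 L × Fin 3 × Fin 4 =>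
          (if p.1 = e.1 then 1 else 0) + (if p.1 = e.1.shift e.2 then 1 else 0)) i : ℕ) * θ * I)) := by
    intro i j
    have h := tp_sub (tp_const_mul ((![1, 1, -1, -1] : Fin 4 → ℂ) i.2.2)
      (tp_wilsonDirac_apply V e κ hκ m₀ 1 i j)) (tp_const _ (z * (1 : Matrix _ _ ℂ) i j))
    obtain ⟨P, hP, hθ⟩ := h
    refine ⟨P, hP, fun θ => ?_⟩
    rw [← hθ θ]
    simp only [hz, Matrix.sub_apply, Matrix.smul_apply, smul_eq_mul, spinorLift_gammaFive_eq_diagonal,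
      Matrix.diagonal_mul]
  have hdet : ∃ P : ℂ[X], P.natDegree ≤ 2 * 24 ∧ ∀ θ : ℝ,
      (fun θ => (hz (Function.update V e (κ θ)) m₀ z).det) θ =
        P.eval (cexp (θ * I)) * cexp (-((24 : ℕ) * θ * I)) := by
    obtain ⟨P, hP, hPθ⟩ := tp_det _ _ hM
    rw [sum_rowDegree e] at hP hPθ
    exact ⟨P, hP, hPθ⟩
  obtain ⟨Q, hQ, hQθ⟩ := tp_mul hdet (tp_star hdet)
  refine fourier ⟨Q, hQ, fun t => ?_⟩
  rw [← hQθ t, ← Complex.normSq_eq_norm_sq, ← Complex.mul_conj]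
  rfl

end SmallBall

open SmallBall Summit.QuantumFields.QCD.Theorems in
/-- STUB `cubeSmallBall` (uniform RELATIVE small balls on the cube fibre).  There are `c, α > 0` such
that for every torus `L ≥ 4`, mass, spectral parameter, sites, background `U` and fibre point `W₀`
with `det ≠ 0`, the product-Haar mass of the fibre points where
`|det(H(refit W) − z)| ≤ ε |det(H(refit W₀) − z)|` is at most `c ε^α` — uniformly in everything
(the constants depend only on the degree `48` and the number `≤ 10⁴` of listed links). -/
theorem stub_cubeSmallBall : ∃ c α : ℝ, 0 < c ∧ 0 < α ∧ ∀ (L : ℕ) [NeZero L], 4 ≤ L →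
    ∀ (m₀ : ℝ) (z : ℂ) (x y : TorusSite 4 L) (U W₀ : GaugeConfig 4 L SU3),
    (hz (refit (touches x y) U W₀) m₀ z).det ≠ 0 → ∀ ε : ℝ, 0 < ε →
    haarPi L {W | ‖(hz (refit (touches x y) U W) m₀ z).det‖ ≤
        ε * ‖(hz (refit (touches x y) U W₀) m₀ z).det‖} ≤ ENNReal.ofReal (c * ε ^ α) := by
  obtain ⟨T, hT⟩ := CircleTransport.exists_diagCircle
  obtain ⟨C, c, hC, hc, hFS⟩ := CircleTransport.stub_haarSmallBalls T hT
    (CircleTransport.stub_eulerWord T hT) (CircleTransport.stub_torusSmallBalls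
      CircleTransport.stub_circleEngine.1 CircleTransport.stub_circleEngine.2) 48 10000
  refine ⟨C, c, hC, hc, ?_⟩
  intro L _ _hL m₀ z x y U W₀ hdet ε hε
  obtain ⟨r, hcover⟩ := exists_listing x y
  set S : Edge 4 L → Bool := touches x y with hS
  set F : GaugeConfig 4 L SU3 → ℝ := fun W => ‖(hz (refit S U W) m₀ z).det‖ with hF
  have hrefit : Continuous fun W : GaugeConfig 4 L SU3 => refit S U W := by
    refine continuous_pi fun e => ?_
    by_cases h : S e = true
    · simp only [refit, h, ↓reduceIte]; exact continuous_apply e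
    · simp only [refit, h, Bool.false_eq_true, ↓reduceIte]; exact continuous_const
  have hFc : Continuous F :=
    ((continuous_const.matrix_mul ((continuous_wilsonDirac (fundamentalRep (Fin 3))
      (continuous_fundamentalRep (Fin 3)) m₀ 1).comp hrefit)).sub continuous_const).matrix_det.norm
  have hupd : ∀ (e : Edge 4 L) (W : GaugeConfig 4 L SU3) (g : SU3),
      refit S U (Function.update W e g) = Function.update (refit S U W) e (if S e then g else U e) := by
    intro e W g
    funext e'
    by_cases h : e' = e
    · subst h; simp only [refit, Function.update_self]
    · simp only [refit, Function.update_of_ne h]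
  have hdep : ∀ W W' : GaugeConfig 4 L SU3, (∀ i, W (r i) = W' (r i)) → F W = F W' := by
    intro W W' h
    have : refit S U W = refit S U W' := by
      funext e
      by_cases he : S e = true
      · obtain ⟨i, rfl⟩ := hcover e he
        simp only [refit, he, ↓reduceIte, h i]
      · simp only [refit, he, Bool.false_eq_true, ↓reduceIte]
    simp only [hF, this]
  have hband : ∀ (W : GaugeConfig 4 L SU3) (i : (Bool × Bool) × (Fin 4 → Fin 5) × Fin 4) (A B : SU3),
      ∃ a : ℤ → ℂ, ∀ t : ℝ, ((F (Function.update W (r i) (A * T t * B)) ^ 2 : ℝ) : ℂ) =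
        ∑ k ∈ Finset.Icc (-((48 : ℕ) : ℤ)) ((48 : ℕ) : ℤ),
          a k * Complex.exp ((k : ℂ) * (t : ℂ) * Complex.I) := by
    intro W i A B
    have hκ : ∀ a b : Fin 3, ∃ p : Polynomial ℂ, p.natDegree ≤ 2 * 1 ∧ ∀ θ : ℝ,
        ((if S (r i) then A * T θ * B else U (r i) : SU3) :
          Matrix (Fin 3) (Fin 3) ℂ) a b = p.eval (Complex.exp (θ * Complex.I)) *
            Complex.exp (-((1 : ℕ) * θ * Complex.I)) := by
      intro a b
      by_cases h : S (r i) = true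
      · simp only [h, ↓reduceIte]; exact tp1_circle hT A B a b
      · simp only [h, Bool.false_eq_true, ↓reduceIte]; exact SingleLinkLogFlatness.tp_const 1 _
    obtain ⟨a, ha⟩ := band (refit S U W) (r i) _ hκ m₀ z
    refine ⟨a, fun t => ?_⟩
    rw [← ha t]
    simp only [hF, hupd]
  have hW₀ : 0 < F W₀ := norm_pos_iff.2 hdet
  have hsb := hFS (Edge 4 L) ((Bool × Bool) × (Fin 4 → Fin 5) × Fin 4) r (by simp) F hFc
    (fun W => norm_nonneg _) hdep hband W₀ hW₀ ε hε
  haveI : IsProbabilityMeasure (haarPi L) := by dsimp only [haarPi]; infer_instance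
  exact (ENNReal.le_ofReal_iff_toReal_le (measure_ne_top _ _) (by positivity)).2 hsb

end Summit.QuantumFields.QCD.Cruxes.FrameAPrioriBound.CubeCofactor

end
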